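import Summits.BirchSwinnertonDyer.BirchSwinnertonDyer.Theorems.GenusKolyvaginAtTwoK4NegOffCutPhantomSelmerDichotomy
import HarnessLib

/-!
# Route `GenusKolyvaginAtTwo`, K₄⁻ kernel `K4Neg` (stmt-BirchSwinnertonDyer-31526), LINE 34 v1.4: the pen's T_C (`PhantomSelmerClassAtTwo_T`)
# and the NPh road F4″ are EXACT NEGATIONS of each other off the cut with `Δ < 0` — at every `2`-split Heegner frame

Width seat `bsd-line-gk2-p4` g33 (cell `bsd-f1-sign2`); `--supports stmt-BirchSwinnertonDyer-31526 --as helper`.  THEOREMS ONLY (no definition,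
no named fact, no `sorry`); standard axioms.  **BSD is NOT proved by this file; `K4Neg` is NOT proved; no item is closed by it.**

WHAT.  LINE 34 v1.4 offers T_C — «there is a NON-ZERO class of `H¹(ℚ, E[2])` dying on `Γ_{ℚ(E[4])}` that lies in the Selmer local condition at
EVERY finite place» — as «the refuter's certificate that (NPh)-type stubs are dead».  This file makes that relation exact and kernel-checked on the
whole OFF-CUT `Δ < 0` cell (no reduction hypothesis at `2`): for `E = W/ℚ` globally minimal, `C(E)` odd, no odd multiplicative prime, `Δ_E < 0`,
`ρ_{E,2^n}` onto, and ANY `2`-split Heegner frame `K`,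
* ★ `exists_phantomSelmerClass_iff_not_nonPhantom_pow` — **T_C's conclusion for `E` ⟺ ¬ (NPh_M ∀M)(E, K)**.
(⟹: the certificate class is Kummer at `v₂`, contradicting g32's `E`-intrinsic criterion; ⟸: the criterion yields a non-zero phantom that IS
Kummer at `v₂`, and off the cut every other place is silent — p784198 §2 `mem_selmerGroup_iff_mem_selmerLocalKer_two_of_offCut_of_Δ_neg`.)
So on this cell T_C is not merely sufficient to kill F4″: it is EQUIVALENT to its failure, frame by frame; with LPF₂ (paper, REF1 §386) both sides
are decided on the good-supersingular sub-cell (T_C true, F4″ false).  BSD is NOT proved by any of this.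

References: [LawsonWuthrich2016] §3, §7.1, §8; [GrossLMS1991] §6, §7, §9; [MilneADT2006] I Lemma 6.15.
-/

set_option autoImplicit false
set_option linter.dupNamespace false -- `Summit.<P>.<Sub>` repeats `BirchSwinnertonDyer` (D-0017)

noncomputable section

open scoped Classical NumberField

namespace Summit.BirchSwinnertonDyer.BirchSwinnertonDyer.Theorems.GenusExact.Lw2PhantomExclusion.TwoAdic

open WeierstrassCurve Field NumberField IsDedekindDomain Rat.HeightOneSpectrum
open Literature.NumberTheory.EllipticCurves Literature.NumberTheory.GaloisRepresentations
open Summit.BirchSwinnertonDyer.BirchSwinnertonDyer.Theorems.GenusExact.VisiblePairAtTwo (natCast_prime_mem_iff_eq)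

/-- ★ **T_C ⟺ ¬F4″, off the cut with `Δ < 0`, at every `2`-split Heegner frame.**  `E = W/ℚ` globally minimal elliptic, `C(E)` odd, no odd
multiplicative prime, `Δ_E < 0`, `ρ_{E,2^n}` onto for all `n`; `K` imaginary quadratic, `d_K` odd, `d_K·(−|Δ|)`, `d_K·(−2|Δ|)` non-squares, Heegner
for `N_E`, `2` split.  Then «∃ `z ≠ 0` in `H¹(ℚ, E[2])` dying on `Γ_{ℚ(E[4])}` and lying in `selmerLocalKer` at EVERY finite place» (the conclusion of
the pen's `PhantomSelmerClassAtTwo_T`, verbatim shape) holds **iff** the `(NPh_M ∀ M)` statement of LINE 34 (Kummer asked at the places over `2N`)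
FAILS for `(E, K)`.  [cite: LawsonWuthrich2016, §3, §7.1, §8] [cite: GrossLMS1991, §9 Prop. 9.1] [cite: MilneADT2006, Ch. I, Lemma 6.15] -/
theorem exists_phantomSelmerClass_iff_not_nonPhantom_pow
    (W : WeierstrassCurve ℚ) [W.IsElliptic] [W.IsGloballyMinimal] [NeZero (W.conductorNorm ℤ)] {K : Type} [Field K] [NumberField K]
    (hρ : ∀ n : ℕ, 0 < n → W.HasSurjectiveModNGaloisRep ((2 : ℤ) ^ n)) (hT : Odd W.tamagawaProduct)
    (hoff : ¬ ∃ v : HeightOneSpectrum (𝓞 ℚ), ((2 : ℕ) : 𝓞 ℚ) ∉ v.asIdeal ∧ ((W.conductorNorm ℤ : ℕ) : 𝓞 ℚ) ∈ v.asIdeal ∧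
      W.HasMultiplicativeReductionAt v)
    (hneg : W.Δ < 0)
    (hK : IsImaginaryQuadratic K) (hodd : Odd (NumberField.discr K)) (hnsq₁ : ¬ IsSquare ((NumberField.discr K : ℚ) * -|W.Δ|))
    (hnsq₂ : ¬ IsSquare ((NumberField.discr K : ℚ) * (-(2 * |W.Δ|))))
    (hH : SatisfiesHeegnerHypothesis (W.conductorNorm ℤ) K) (h2K : ((Ideal.span {(2 : ℤ)}).primesOver (𝓞 K)).ncard = 2) :
    (∃ z : galH1Torsion W ((2 : ℕ) : ℤ), z ≠ 0 ∧
        (∀ ρ' ∈ torsionFixing W ((4 : ℕ) : ℤ), h1Eval W ((2 : ℕ) : ℤ) z ρ' = 0) ∧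
        (∀ v : HeightOneSpectrum (𝓞 ℚ), z ∈ selmerLocalKer W (v.adicCompletion ℚ) ((2 : ℕ) : ℤ))) ↔
      ¬ ∀ (Mlev : ℕ), 1 ≤ Mlev → ∀ z : galH1Torsion (W.baseChange K) ((2 ^ Mlev : ℕ) : ℤ),
        (∀ ρ ∈ torsionFixing (W.baseChange K) ((2 ^ Mlev : ℕ) : ℤ), h1Eval (W.baseChange K) ((2 ^ Mlev : ℕ) : ℤ) z ρ = 0) →
        (∀ w : HeightOneSpectrum (𝓞 K), ((2 * W.conductorNorm ℤ : ℕ) : 𝓞 K) ∈ w.asIdeal →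
          z ∈ selmerLocalKer (W.baseChange K) (w.adicCompletion K) ((2 ^ Mlev : ℕ) : ℤ)) → z = 0 := by
  set v₂ : HeightOneSpectrum (𝓞 ℚ) := primesEquiv.symm ⟨2, Nat.prime_two⟩ with hv₂def
  have hv₂ : ((2 : ℕ) : 𝓞 ℚ) ∈ v₂.asIdeal := (natCast_prime_mem_iff_eq Nat.prime_two v₂).mpr rfl
  rw [nonPhantom_pow_iff_forall_not_mem_selmerLocalKer_two_of_offCut W hρ hT hoff hK hodd hnsq₁ hnsq₂ hH h2K]
  constructor
  · rintro ⟨z, hz0, hz, hzS⟩ hcrit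
    exact hcrit z hz0 (fun h hh ↦ hz h (by exact_mod_cast hh)) (hzS v₂)
  · intro hcrit
    push Not at hcrit
    obtain ⟨x, hx0, hx, hxS⟩ := hcrit
    have hx' : ∀ ρ ∈ torsionFixing W (4 : ℤ), h1Eval W ((2 : ℕ) : ℤ) x ρ = 0 := fun ρ hρ' ↦ hx ρ hρ'
    have hxSel : x ∈ W.selmerGroup ((2 : ℕ) : ℤ) :=
      (mem_selmerGroup_iff_mem_selmerLocalKer_two_of_offCut_of_Δ_neg W hT hoff hneg v₂ hv₂ hx').mpr hxS
    refine ⟨x, hx0, fun ρ' hρ' ↦ hx ρ' (by exact_mod_cast hρ'), fun v ↦ ((W.mem_selmerGroup_iff _ x).mp hxSel).1 v⟩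

/-- **Corollary: off the cut with `Δ < 0`, the truth value of F4″ does not depend on the `2`-split Heegner frame** — it is the negation of an
`E`-intrinsic statement (g32 had the frame-independence of (NPh) itself; this is the T_C form).  [cite: LawsonWuthrich2016, §7.1, §8] -/
theorem nonPhantom_pow_iff_of_two_frames
    (W : WeierstrassCurve ℚ) [W.IsElliptic] [W.IsGloballyMinimal] [NeZero (W.conductorNorm ℤ)]
    {K K' : Type} [Field K] [NumberField K] [Field K'] [NumberField K']
    (hρ : ∀ n : ℕ, 0 < n → W.HasSurjectiveModNGaloisRep ((2 : ℤ) ^ n)) (hT : Odd W.tamagawaProduct)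
    (hoff : ¬ ∃ v : HeightOneSpectrum (𝓞 ℚ), ((2 : ℕ) : 𝓞 ℚ) ∉ v.asIdeal ∧ ((W.conductorNorm ℤ : ℕ) : 𝓞 ℚ) ∈ v.asIdeal ∧
      W.HasMultiplicativeReductionAt v)
    (hneg : W.Δ < 0)
    (hK : IsImaginaryQuadratic K) (hodd : Odd (NumberField.discr K)) (hnsq₁ : ¬ IsSquare ((NumberField.discr K : ℚ) * -|W.Δ|))
    (hnsq₂ : ¬ IsSquare ((NumberField.discr K : ℚ) * (-(2 * |W.Δ|))))
    (hH : SatisfiesHeegnerHypothesis (W.conductorNorm ℤ) K) (h2K : ((Ideal.span {(2 : ℤ)}).primesOver (𝓞 K)).ncard = 2)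
    (hK' : IsImaginaryQuadratic K') (hodd' : Odd (NumberField.discr K')) (hnsq₁' : ¬ IsSquare ((NumberField.discr K' : ℚ) * -|W.Δ|))
    (hnsq₂' : ¬ IsSquare ((NumberField.discr K' : ℚ) * (-(2 * |W.Δ|))))
    (hH' : SatisfiesHeegnerHypothesis (W.conductorNorm ℤ) K') (h2K' : ((Ideal.span {(2 : ℤ)}).primesOver (𝓞 K')).ncard = 2) :
    (∀ (Mlev : ℕ), 1 ≤ Mlev → ∀ z : galH1Torsion (W.baseChange K) ((2 ^ Mlev : ℕ) : ℤ),
        (∀ ρ ∈ torsionFixing (W.baseChange K) ((2 ^ Mlev : ℕ) : ℤ), h1Eval (W.baseChange K) ((2 ^ Mlev : ℕ) : ℤ) z ρ = 0) →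
        (∀ w : HeightOneSpectrum (𝓞 K), ((2 * W.conductorNorm ℤ : ℕ) : 𝓞 K) ∈ w.asIdeal →
          z ∈ selmerLocalKer (W.baseChange K) (w.adicCompletion K) ((2 ^ Mlev : ℕ) : ℤ)) → z = 0) ↔
      (∀ (Mlev : ℕ), 1 ≤ Mlev → ∀ z : galH1Torsion (W.baseChange K') ((2 ^ Mlev : ℕ) : ℤ),
        (∀ ρ ∈ torsionFixing (W.baseChange K') ((2 ^ Mlev : ℕ) : ℤ), h1Eval (W.baseChange K') ((2 ^ Mlev : ℕ) : ℤ) z ρ = 0) →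
        (∀ w : HeightOneSpectrum (𝓞 K'), ((2 * W.conductorNorm ℤ : ℕ) : 𝓞 K') ∈ w.asIdeal →
          z ∈ selmerLocalKer (W.baseChange K') (w.adicCompletion K') ((2 ^ Mlev : ℕ) : ℤ)) → z = 0) := by
  have h₁ := exists_phantomSelmerClass_iff_not_nonPhantom_pow W hρ hT hoff hneg hK hodd hnsq₁ hnsq₂ hH h2K
  have h₂ := exists_phantomSelmerClass_iff_not_nonPhantom_pow W hρ hT hoff hneg hK' hodd' hnsq₁' hnsq₂' hH' h2K'
  exact not_iff_not.mp (h₁.symm.trans h₂)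

end Summit.BirchSwinnertonDyer.BirchSwinnertonDyer.Theorems.GenusExact.Lw2PhantomExclusion.TwoAdic

end
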